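import Literature.NumberTheory.Sieve.RomanovTheorem
import Literature.NumberTheory.Sieve.ChenTheorem
import HarnessLib

/-!
# Pintz–Ruzsa I, §8: the singular-series sum over differences of powers of `2`, and `R₀`

Topic `Literature/NumberTheory/Sieve` (additive problems with primes and powers of `2`); sequel to
`RomanovTheorem.lean` (Romanov's lemma with the weight `1/φ(d)`). Everything here is PROVED; the
only new real number, Pintz–Ruzsa's constant `R₀`, is DEFINED as the sum of a series proved
convergent — its numerical value (`1.936 < R₀ < 1.94`, Khalfalah–Pintz) is a computation and is
NOT asserted anywhere in this file.

J. Pintz, I. Z. Ruzsa, *On Linnik's approximation to Goldbach's problem, I*, Acta Arith. 109 (2003)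
169–194, §8, proof of Lemma 10 (`s(N) ≤ (2/log² 2) C₂ N`, the mean value `∫₀¹ |S(α)G(α)|² dα`, an
input of Lemma 13 and so of the Goldbach–Linnik theorem `Literature.NumberTheory.Sieve.goldbach_linnik`,
parity.S36): after Chen's prime-pair bound `R(h) < C · 2C₀ f(h) N/log² N` ((2.11)–(2.12), `f(h) =
∏_{p ∣ h, p>2} (1 + 1/(p-2))`; in the tree with `C = 4 + ε`, `PrimePairsLinearSieveUpper.lean`) one
needs the arithmetic estimate (8.7)–(8.14)

  `2 ∑_{1 ≤ m₁ < m₂ ≤ L} f(2^{m₂} - 2^{m₁}) = 2 ∑_{l<L} (L - l) f(2^l - 1) ≤ L² F₀(L) ≤ L² R₀`,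
  `F₀(L) = ∑'_{d ≤ 2^L} k(d)/ϱ(d)`, `k(d) = ∏_{p ∣ d} 1/(p-2)`, `ϱ(d)` = order of `2` mod `d`,

with `R₀ = lim F₀(L) = ∑'_{d odd, square-free} k(d)/ϱ(d)` (Romanov). This file proves exactly that:

* `kWeight`, `fWeight` (`k`, `f`), `singularSeries_eq_twinPrimeConst_mul_fWeight`
  (`Chen.singularSeries h = C₂ f(h)`: Pintz–Ruzsa's `2C₀ f(h)` is the Hardy–Littlewood constant),
  `fWeight_two_pow_mul` (`f(2^a n) = f(n)`), `fWeight_eq_sum_divisors` ((8.10):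
  `f(h) = ∑'_{d ∣ h} k(d)`, by multiplicativity: `kappa`, `fFun`);
* `sum_kWeight_le_log_sq` (`∑_{ϱ(d) ≤ x} k(d) ≤ e¹⁴ log² x`, through `Romanov.primesOrdLE` and
  `Romanov.sum_primesOrdLE_inv_pred_le`), `sum_kWeight_div_ordTwo_le` (every partial sum of
  `∑' k(d)/ϱ(d)` is `≤ 6e¹⁴`, dyadic blocks), `summable_kappa_div_ordTwo`,
  `romanovConstPR = R₀ := ∑' d, κ(d)/ϱ(d)`, `sum_kappa_div_ordTwo_le_romanovConstPR` (`F₀(L) ≤ R₀`);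
* `sum_filter_dvd_sub_le` ((8.12): `∑_{l<L, ϱ∣l} (L - l) ≤ L²/(2ϱ)`),
  `sum_Ico_sub_mul_fWeight_le` ((8.11)–(8.13)), `sum_pairs_fWeight_eq` (the regrouping by
  `l = m₂ - m₁` in (8.7)) and `sum_pairs_fWeight_le`:
  `∑_{1 ≤ m₁ < m₂ ≤ L} f(2^{m₂} - 2^{m₁}) ≤ (L²/2) R₀`.

Constants in the convergence proof are explicit and crude (`6e¹⁴`); only the structure
`≤ (L²/2) R₀` with THE constant `R₀` matters downstream.

## References

* J. Pintz, I. Z. Ruzsa, *On Linnik's approximation to Goldbach's problem, I*, Acta Arith. 109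
  (2003) 169–194, §2 (2.12), §8 (8.7)–(8.14). [PintzRuzsa2003]
* N. P. Romanoff, *Über einige Sätze der additiven Zahlentheorie*, Math. Ann. 109 (1934) 668–678
  (convergence of `F₀`). [Romanoff1934]
* M. B. Nathanson, *Additive Number Theory: The Classical Bases*, GTM 164 (1996), §7.6 Lemma 7.8.
  [Nathanson1996]
-/

noncomputable section

open Finset Filter

namespace Literature.NumberTheory.Sieve

namespace PintzRuzsa2003

open Romanov

/-! ### The weights `k(d)` and `f(h)` -/

/-- Pintz–Ruzsa's `k(d) = ∏_{p ∣ d} 1/(p - 2)` ((8.10); there for odd square-free `d`; here over the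
distinct prime factors of any `d`, and `= 0` for even `d` since the factor at `p = 2` is `1/0 = 0`).
[cite: PintzRuzsa2003, §8 (8.10)] -/
def kWeight (d : ℕ) : ℝ := ∏ p ∈ d.primeFactors, 1 / ((p : ℝ) - 2)

/-- Pintz–Ruzsa's `f(h) = ∏_{p ∣ h, p > 2} (1 + 1/(p - 2))` ((2.12)), the arithmetic factor of the
prime-pair count `R(h)`; `f(h) = 𝔖(h)/(2C₀)` with the Hardy–Littlewood constant `𝔖(h)`.
[cite: PintzRuzsa2003, §2 (2.12)] -/
def fWeight (h : ℕ) : ℝ := ∏ p ∈ h.primeFactors.filter (2 < ·), (1 + 1 / ((p : ℝ) - 2))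

/-- `k(d) ≥ 0` for odd `d`. [folklore] -/
theorem kWeight_nonneg {d : ℕ} (hd : Odd d) : 0 ≤ kWeight d := by
  unfold kWeight
  refine Finset.prod_nonneg fun p hp => ?_
  have hpp := Nat.prime_of_mem_primeFactors hp
  have hp2 : p ≠ 2 := by
    rintro rfl
    exact (Nat.not_even_iff_odd.mpr hd) (even_iff_two_dvd.mpr (Nat.dvd_of_mem_primeFactors hp))
  have hp3 : (3 : ℝ) ≤ p := by exact_mod_cast hpp.two_le.lt_of_ne (Ne.symm hp2)
  have : (0 : ℝ) < p - 2 := by linarith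
  positivity

/-- `f(h) ≥ 1`. [folklore] -/
theorem one_le_fWeight (h : ℕ) : 1 ≤ fWeight h := by
  unfold fWeight
  calc (1 : ℝ) = ∏ p ∈ h.primeFactors.filter (2 < ·), (1 : ℝ) := by simp
    _ ≤ ∏ p ∈ h.primeFactors.filter (2 < ·), (1 + 1 / ((p : ℝ) - 2)) := by
        refine Finset.prod_le_prod (fun _ _ => zero_le_one) fun p hp => ?_
        have hp3 : 2 < p := (Finset.mem_filter.mp hp).2
        have hp3' : (3 : ℝ) ≤ p := by exact_mod_cast hp3
        have : (0 : ℝ) < p - 2 := by linarith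
        have : 0 ≤ 1 / ((p : ℝ) - 2) := by positivity
        linarith

/-- **`𝔖`-normalisation**: `Chen.singularSeries h = C₂ · f(h)` (`(p-1)/(p-2) = 1 + 1/(p-2)`), so that
Pintz–Ruzsa's `2C₀ f(h)` (with `C₀ = C₂ = Literature.twinPrimeConst`) is twice Chen's / Nathanson's
singular series. [cite: PintzRuzsa2003, §2 (2.7), (2.12)] -/
theorem singularSeries_eq_twinPrimeConst_mul_fWeight (h : ℕ) :
    Chen.singularSeries h = twinPrimeConst * fWeight h := by
  unfold Chen.singularSeries fWeight
  congr 1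
  refine Finset.prod_congr rfl fun p hp => ?_
  have hp3 : 2 < p := (Finset.mem_filter.mp hp).2
  have hp3' : (3 : ℝ) ≤ p := by exact_mod_cast hp3
  have : (p : ℝ) - 2 ≠ 0 := by linarith
  field_simp
  ring

/-- `f` ignores the prime `2`: `f(2^a · n) = f(n)` for odd `n`. [folklore] -/
theorem fWeight_two_pow_mul {a n : ℕ} (hn : Odd n) : fWeight (2 ^ a * n) = fWeight n := by
  rcases Nat.eq_zero_or_pos a with rfl | ha
  · rw [pow_zero, one_mul]
  have hn0 : n ≠ 0 := by rintro rfl; exact (Nat.not_even_iff_odd.mpr hn) (by decide)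
  unfold fWeight
  congr 1
  have hcop : Nat.Coprime (2 ^ a) n := Nat.Coprime.pow_left _ (Nat.coprime_two_left.mpr hn)
  rw [hcop.primeFactors_mul, Finset.filter_union, Nat.primeFactors_prime_pow ha.ne' Nat.prime_two,
    Finset.filter_singleton, if_neg (lt_irrefl 2), Finset.empty_union]

/-! ### `f(h) = ∑'_{d ∣ h} k(d)` ((8.10)) -/

/-- `κ(d) = k(d)` for odd square-free `d`, `0` otherwise, as a real arithmetic function (the terms of
Pintz–Ruzsa's primed sums `∑'`). [cite: PintzRuzsa2003, §8 (8.10)] -/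
def kappa : ArithmeticFunction ℝ :=
  ⟨fun d => if Odd d ∧ Squarefree d then kWeight d else 0, by
    rw [if_neg]
    rintro ⟨h, -⟩
    exact (Nat.not_even_iff_odd.mpr h) (by decide)⟩

/-- Unfolding `κ`. [folklore] -/
theorem kappa_apply (d : ℕ) : kappa d = if Odd d ∧ Squarefree d then kWeight d else 0 := rfl

/-- `κ ≥ 0`. [folklore] -/
theorem kappa_nonneg (d : ℕ) : 0 ≤ kappa d := by
  rw [kappa_apply]
  split_ifs with h
  · exact kWeight_nonneg h.1
  · exact le_rfl

/-- `k` is multiplicative on coprime arguments. [folklore] -/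
theorem kWeight_mul {m n : ℕ} (hmn : Nat.Coprime m n) : kWeight (m * n) = kWeight m * kWeight n := by
  unfold kWeight
  rw [hmn.primeFactors_mul, Finset.prod_union hmn.disjoint_primeFactors]

/-- `κ` is multiplicative. [folklore] -/
theorem isMultiplicative_kappa : kappa.IsMultiplicative := by
  refine ⟨?_, fun {m n} hmn => ?_⟩
  · rw [kappa_apply, if_pos ⟨odd_one, squarefree_one⟩]
    simp [kWeight]
  · simp only [kappa_apply, Nat.odd_mul, Nat.squarefree_mul_iff, kWeight_mul hmn]
    by_cases hm : Odd m ∧ Squarefree m <;> by_cases hn : Odd n ∧ Squarefree n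
    · rw [if_pos ⟨⟨hm.1, hn.1⟩, hmn, hm.2, hn.2⟩, if_pos hm, if_pos hn]
    · rw [if_pos hm, if_neg hn, mul_zero, if_neg]
      rintro ⟨⟨-, h1⟩, -, -, h2⟩
      exact hn ⟨h1, h2⟩
    · rw [if_neg hm, zero_mul, if_neg]
      rintro ⟨⟨h1, -⟩, -, h2, -⟩
      exact hm ⟨h1, h2⟩
    · rw [if_neg hm, zero_mul, if_neg]
      rintro ⟨⟨h1, -⟩, -, h2, -⟩
      exact hm ⟨h1, h2⟩

/-- `h ↦ f(h)` (with value `0` at `h = 0`) as a real arithmetic function. [folklore] -/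
def fFun : ArithmeticFunction ℝ :=
  ⟨fun h => if h = 0 then 0 else fWeight h, if_pos rfl⟩

/-- Unfolding `fFun`. [folklore] -/
theorem fFun_apply (h : ℕ) : fFun h = if h = 0 then 0 else fWeight h := rfl

/-- `fFun` is multiplicative. [folklore] -/
theorem isMultiplicative_fFun : fFun.IsMultiplicative := by
  refine ArithmeticFunction.IsMultiplicative.iff_ne_zero.2 ⟨?_, ?_⟩
  · rw [fFun_apply, if_neg one_ne_zero]
    simp [fWeight]
  · intro m n hm hn hmn
    rw [fFun_apply, if_neg (Nat.mul_ne_zero hm hn), fFun_apply, if_neg hm, fFun_apply, if_neg hn]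
    unfold fWeight
    rw [hmn.primeFactors_mul, Finset.filter_union, Finset.prod_union]
    exact Finset.disjoint_filter_filter hmn.disjoint_primeFactors

/-- **(8.10)** `f(h) = ∑_{d ∣ h} κ(d) = ∑'_{d ∣ h, d odd square-free} k(d)` for `h ≠ 0` (both sides
are multiplicative and agree on prime powers: at `2^a` both are `1`, at `p^a`, `p` odd, both are
`1 + 1/(p-2)`). [cite: PintzRuzsa2003, §8 (8.10)] -/
theorem fWeight_eq_sum_divisors {h : ℕ} (hh : h ≠ 0) : fWeight h = ∑ d ∈ h.divisors, kappa d := by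
  have hζ : ((ArithmeticFunction.zeta : ArithmeticFunction ℕ) : ArithmeticFunction ℝ).IsMultiplicative :=
    ArithmeticFunction.isMultiplicative_zeta.natCast
  have hmul := isMultiplicative_kappa.mul hζ
  have heq : fFun = kappa * (ArithmeticFunction.zeta : ArithmeticFunction ℕ) := by
    rw [ArithmeticFunction.IsMultiplicative.eq_iff_eq_on_prime_powers _ isMultiplicative_fFun _ hmul]
    intro p a hp
    rw [ArithmeticFunction.coe_mul_zeta_apply, Nat.sum_divisors_prime_pow hp, fFun_apply,
      if_neg (pow_ne_zero _ hp.ne_zero)]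
    rcases Nat.eq_zero_or_pos a with rfl | ha
    · simp [fWeight, kappa_apply, kWeight]
    -- `a ≥ 1`
    have hkap1 : kappa 1 = 1 := isMultiplicative_kappa.map_one
    have hval : ∀ j ∈ Finset.range a, kappa (p ^ (j + 1)) =
        if j = 0 then (if p = 2 then 0 else 1 / ((p : ℝ) - 2)) else 0 := by
      intro j _
      rw [kappa_apply]
      rcases Nat.eq_zero_or_pos j with rfl | hj
      · simp only [zero_add, pow_one, if_true]
        by_cases hp2 : p = 2
        · subst hp2
          rw [if_neg (by decide), if_pos rfl]
        · have hodd : Odd p := hp.odd_of_ne_two hp2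
          rw [if_pos ⟨hodd, hp.squarefree⟩, if_neg hp2]
          simp [kWeight, Nat.Prime.primeFactors hp]
      · have hns : ¬ Squarefree (p ^ (j + 1)) := by
          rw [Nat.squarefree_pow_iff hp.ne_one (by omega)]
          rintro ⟨-, h⟩; omega
        rw [if_neg fun h => hns h.2, if_neg hj.ne']
    rw [Finset.sum_range_succ', pow_zero, hkap1, Finset.sum_congr rfl hval,
      Finset.sum_ite_eq' (Finset.range a) 0, if_pos (Finset.mem_range.mpr ha)]
    -- left side
    unfold fWeight
    rw [Nat.primeFactors_prime_pow ha.ne' hp, Finset.filter_singleton]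
    by_cases hp2 : p = 2
    · subst hp2
      rw [if_neg (lt_irrefl 2), Finset.prod_empty, if_pos rfl]
      ring
    · have hp3 : 2 < p := lt_of_le_of_ne hp.two_le (Ne.symm hp2)
      rw [if_pos hp3, Finset.prod_singleton, if_neg hp2]
      ring
  have := congrArg (fun F : ArithmeticFunction ℝ => F h) heq
  simp only [fFun_apply, if_neg hh, ArithmeticFunction.coe_mul_zeta_apply] at this
  exact this

/-! ### Romanov's series with the weight `k(d)`: `R₀ = ∑' k(d)/e(d)` -/

/-- **Square-free sums against Euler products** (general weight): if every `d ∈ S` is square-free with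
all prime factors in `P`, and `w ≥ 0` on `P`, then `∑_{d ∈ S} ∏_{p ∣ d} w(p) ≤ ∏_{p ∈ P} (1 + w(p))`.
[folklore] -/
theorem sum_prod_primeFactors_le_prod_one_add {S P : Finset ℕ} (w : ℕ → ℝ) (hw : ∀ p ∈ P, 0 ≤ w p)
    (hS : ∀ d ∈ S, Squarefree d ∧ d.primeFactors ⊆ P) :
    ∑ d ∈ S, ∏ p ∈ d.primeFactors, w p ≤ ∏ p ∈ P, (1 + w p) := by
  classical
  rw [Finset.prod_one_add]
  have hinj : Set.InjOn Nat.primeFactors (S : Set ℕ) := by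
    intro d₁ h₁ d₂ h₂ heq
    have e₁ := Nat.prod_primeFactors_of_squarefree (hS d₁ h₁).1
    have e₂ := Nat.prod_primeFactors_of_squarefree (hS d₂ h₂).1
    rw [← e₁, ← e₂]
    exact congrArg (fun t : Finset ℕ => ∏ p ∈ t, p) heq
  calc ∑ d ∈ S, ∏ p ∈ d.primeFactors, w p
      = ∑ t ∈ S.image Nat.primeFactors, ∏ p ∈ t, w p := by rw [Finset.sum_image hinj]
    _ ≤ ∑ t ∈ P.powerset, ∏ p ∈ t, w p := by
        refine Finset.sum_le_sum_of_subset_of_nonneg (fun t ht => ?_) fun t ht _ => ?_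
        · obtain ⟨d, hd, rfl⟩ := Finset.mem_image.mp ht
          exact Finset.mem_powerset.mpr (hS d hd).2
        · exact Finset.prod_nonneg fun p hp => hw p (Finset.mem_powerset.mp ht hp)

/-- **`E_k(x) ≪ log² x`**: for `x ≥ 2` and odd square-free `d` with `e(d) ≤ x`,
`∑ k(d) ≤ e¹⁴ (log x)²` (every prime factor lies in `Romanov.primesOrdLE x`; `1/(p-2) ≤ 2/(p-1)` for
`p ≥ 3` and `Romanov.sum_primesOrdLE_inv_pred_le`). [cite: PintzRuzsa2003, §8 (8.13)–(8.14)] -/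
theorem sum_kWeight_le_log_sq {x : ℕ} (hx : 2 ≤ x) {S : Finset ℕ}
    (hS : ∀ d ∈ S, Odd d ∧ Squarefree d ∧ ordTwo d ≤ x) :
    ∑ d ∈ S, kWeight d ≤ Real.exp 14 * Real.log x ^ 2 := by
  have hx2 : (2 : ℝ) ≤ x := by exact_mod_cast hx
  have hlogx0 : 0 < Real.log x := Real.log_pos (by linarith)
  set P := primesOrdLE x with hP
  have hP3 : ∀ p ∈ P, (3 : ℝ) ≤ p := fun p hp => by
    obtain ⟨hpp, hodd, -⟩ := mem_primesOrdLE.mp hp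
    have hp2 : p ≠ 2 := by rintro rfl; exact (Nat.not_even_iff_odd.mpr hodd) even_two
    exact_mod_cast hpp.two_le.lt_of_ne (Ne.symm hp2)
  have hw : ∀ p ∈ P, 0 ≤ 1 / ((p : ℝ) - 2) := fun p hp => by
    have := hP3 p hp
    have : (0 : ℝ) < p - 2 := by linarith
    positivity
  have hS' : ∀ d ∈ S, Squarefree d ∧ d.primeFactors ⊆ P := by
    intro d hd
    obtain ⟨hodd, hsq, hle⟩ := hS d hd
    refine ⟨hsq, fun p hp => ?_⟩
    have hpp : p.Prime := Nat.prime_of_mem_primeFactors hp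
    have hpd : p ∣ d := Nat.dvd_of_mem_primeFactors hp
    exact mem_primesOrdLE.mpr ⟨hpp, hodd.of_dvd_nat hpd, (ordTwo_le_ordTwo_of_dvd hodd hpd).trans hle⟩
  have h1 : ∑ d ∈ S, kWeight d ≤ ∏ p ∈ P, (1 + 1 / ((p : ℝ) - 2)) :=
    sum_prod_primeFactors_le_prod_one_add (fun p => 1 / ((p : ℝ) - 2)) hw hS'
  have h2 : ∏ p ∈ P, (1 + 1 / ((p : ℝ) - 2)) ≤ Real.exp (∑ p ∈ P, 2 * (1 / ((p : ℝ) - 1))) := by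
    rw [Real.exp_sum]
    refine Finset.prod_le_prod (fun p hp => by linarith [hw p hp]) fun p hp => ?_
    have hp3 := hP3 p hp
    have hle : 1 / ((p : ℝ) - 2) ≤ 2 * (1 / ((p : ℝ) - 1)) := by
      rw [mul_one_div, div_le_div_iff₀ (by linarith) (by linarith)]
      linarith
    have := Real.add_one_le_exp (2 * (1 / ((p : ℝ) - 1)))
    linarith
  have h3 : ∑ p ∈ P, 2 * (1 / ((p : ℝ) - 1)) ≤ 2 * (Real.log (Real.log x) + 7) := by
    rw [← Finset.mul_sum]
    exact mul_le_mul_of_nonneg_left (sum_primesOrdLE_inv_pred_le hx) (by norm_num)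
  calc ∑ d ∈ S, kWeight d ≤ Real.exp (∑ p ∈ P, 2 * (1 / ((p : ℝ) - 1))) := h1.trans h2
    _ ≤ Real.exp (2 * (Real.log (Real.log x) + 7)) := Real.exp_le_exp.mpr h3
    _ = Real.exp 14 * Real.log x ^ 2 := by
        rw [show 2 * (Real.log (Real.log x) + 7) = (14 : ℝ) + ((2 : ℕ) : ℝ) * Real.log (Real.log x) by
          push_cast; ring, Real.exp_add, Real.exp_nat_mul, Real.exp_log hlogx0]

/-- `∑_{j < n} (j+1)²/2^j = 12 - 2(n² + 4n + 6)/2^n ≤ 12`. [folklore] -/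
theorem sum_range_succ_sq_div_two_pow_le (n : ℕ) :
    ∑ j ∈ Finset.range n, ((j : ℝ) + 1) ^ 2 / 2 ^ j ≤ 12 := by
  have h : ∀ n : ℕ, ∑ j ∈ Finset.range n, ((j : ℝ) + 1) ^ 2 / 2 ^ j =
      12 - 2 * ((n : ℝ) ^ 2 + 4 * n + 6) / 2 ^ n := by
    intro n
    induction n with
    | zero => norm_num
    | succ n ih =>
        rw [Finset.sum_range_succ, ih, pow_succ]
        have : (2 : ℝ) ^ n ≠ 0 := pow_ne_zero _ two_ne_zero
        field_simp
        push_cast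
        ring
  rw [h n]
  have : 0 ≤ 2 * ((n : ℝ) ^ 2 + 4 * n + 6) / 2 ^ n := by positivity
  linarith

/-- **Romanov's lemma with Pintz–Ruzsa's weight `k(d)`**: every finite sum `∑ k(d)/e(d)` over odd
square-free `d` is `≤ 6e¹⁴` (dyadic blocks in `e(d)`, `sum_kWeight_le_log_sq` at `x = 2^{j+1}`,
`∑_j (j+1)² (log 2)²/2^j = 12 log² 2 < 6`). The VALUE of the full series, Pintz–Ruzsa's `R₀`
(`1.936 < R₀ < 1.94`, Khalfalah–Pintz, a computation), is not addressed. [cite: PintzRuzsa2003, §8 (8.13)–(8.14)] -/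
theorem sum_kWeight_div_ordTwo_le (S : Finset ℕ) (hS : ∀ d ∈ S, Odd d ∧ Squarefree d) :
    ∑ d ∈ S, kWeight d / ordTwo d ≤ 6 * Real.exp 14 := by
  classical
  set jf : ℕ → ℕ := fun d => Nat.log 2 (ordTwo d) with hjf
  set J : Finset ℕ := S.image jf with hJ
  have hl2 : (0.6931471803 : ℝ) < Real.log 2 := Real.log_two_gt_d9
  have hl2' : Real.log 2 < 0.6931471808 := Real.log_two_lt_d9
  have hpt : ∀ d ∈ S, kWeight d / ordTwo d ≤ (1 / 2 ^ jf d) * kWeight d := by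
    intro d hd
    have hodd := (hS d hd).1
    have he : 0 < ordTwo d := ordTwo_pos hodd
    have hk : 0 ≤ kWeight d := kWeight_nonneg hodd
    have hpow : (2 : ℝ) ^ jf d ≤ ordTwo d := by exact_mod_cast Nat.pow_log_le_self 2 he.ne'
    rw [div_eq_mul_inv, mul_comm, one_div]
    exact mul_le_mul_of_nonneg_right (inv_anti₀ (by positivity) hpow) hk
  have hfib : ∀ j ∈ J, ∑ d ∈ S with jf d = j, (1 / 2 ^ jf d) * kWeight d ≤
      Real.exp 14 * Real.log 2 ^ 2 * ((((j : ℝ) + 1) ^ 2) / 2 ^ j) := by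
    intro j _
    have hx : 2 ≤ 2 ^ (j + 1) := by
      calc (2 : ℕ) = 2 ^ 1 := by norm_num
        _ ≤ 2 ^ (j + 1) := Nat.pow_le_pow_right (by norm_num) (by omega)
    have hin : ∀ d ∈ S.filter (fun d => jf d = j), Odd d ∧ Squarefree d ∧ ordTwo d ≤ 2 ^ (j + 1) := by
      intro d hd
      rw [Finset.mem_filter] at hd
      refine ⟨(hS d hd.1).1, (hS d hd.1).2, ?_⟩
      have := Nat.lt_pow_succ_log_self (b := 2) (by norm_num) (ordTwo d)
      rw [← hd.2]
      exact this.le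
    have hE := sum_kWeight_le_log_sq hx hin
    calc ∑ d ∈ S with jf d = j, (1 / 2 ^ jf d) * kWeight d
        = ∑ d ∈ S with jf d = j, (1 / 2 ^ j) * kWeight d := by
          refine Finset.sum_congr rfl fun d hd => ?_
          rw [(Finset.mem_filter.mp hd).2]
      _ = (1 / 2 ^ j) * ∑ d ∈ S with jf d = j, kWeight d := by rw [Finset.mul_sum]
      _ ≤ (1 / 2 ^ j) * (Real.exp 14 * Real.log ((2 ^ (j + 1) : ℕ) : ℝ) ^ 2) :=
          mul_le_mul_of_nonneg_left hE (by positivity)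
      _ = Real.exp 14 * Real.log 2 ^ 2 * ((((j : ℝ) + 1) ^ 2) / 2 ^ j) := by
          push_cast
          rw [Real.log_pow]
          push_cast
          ring
  have hJsub : J ⊆ Finset.range (J.sup id + 1) := fun j hj =>
    Finset.mem_range.mpr (Nat.lt_succ_of_le (Finset.le_sup (f := id) hj))
  calc ∑ d ∈ S, kWeight d / ordTwo d
      ≤ ∑ d ∈ S, (1 / 2 ^ jf d) * kWeight d := Finset.sum_le_sum hpt
    _ = ∑ j ∈ J, ∑ d ∈ S with jf d = j, (1 / 2 ^ jf d) * kWeight d := by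
        rw [Finset.sum_fiberwise_of_maps_to (fun d hd => Finset.mem_image_of_mem jf hd)]
    _ ≤ ∑ j ∈ J, Real.exp 14 * Real.log 2 ^ 2 * ((((j : ℝ) + 1) ^ 2) / 2 ^ j) := Finset.sum_le_sum hfib
    _ ≤ ∑ j ∈ Finset.range (J.sup id + 1), Real.exp 14 * Real.log 2 ^ 2 * ((((j : ℝ) + 1) ^ 2) / 2 ^ j) :=
        Finset.sum_le_sum_of_subset_of_nonneg hJsub fun j _ _ => by positivity
    _ = Real.exp 14 * Real.log 2 ^ 2 * ∑ j ∈ Finset.range (J.sup id + 1), (((j : ℝ) + 1) ^ 2) / 2 ^ j := by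
        rw [Finset.mul_sum]
    _ ≤ Real.exp 14 * Real.log 2 ^ 2 * 12 :=
        mul_le_mul_of_nonneg_left (sum_range_succ_sq_div_two_pow_le _) (by positivity)
    _ ≤ 6 * Real.exp 14 := by
        have hsq : Real.log 2 ^ 2 * 12 ≤ 6 := by nlinarith
        nlinarith [mul_le_mul_of_nonneg_left hsq (Real.exp_pos 14).le]

/-- **Pintz–Ruzsa's constant `R₀ = ∑'_{d odd, square-free} k(d)/ϱ(d)`** ((8.13)–(8.14): the limit of
`F₀(L) = ∑'_{d ≤ 2^L} k(d)/ϱ(d)`; Romanov proved convergence, Khalfalah–Pintz computed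
`1.936 < R₀ < 1.94` — that numerical value is NOT asserted here), as the sum of the series
`∑_d κ(d)/e(d)`. [cite: PintzRuzsa2003, §8 (8.14)] -/
def romanovConstPR : ℝ := ∑' d : ℕ, kappa d / ordTwo d

/-- The terms `κ(d)/e(d)` are nonnegative. [folklore] -/
theorem kappa_div_ordTwo_nonneg (d : ℕ) : 0 ≤ kappa d / ordTwo d :=
  div_nonneg (kappa_nonneg d) (Nat.cast_nonneg _)

/-- Partial sums of `∑ κ(d)/e(d)` are `≤ 6e¹⁴`. [cite: PintzRuzsa2003, §8 (8.13)–(8.14)] -/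
theorem sum_kappa_div_ordTwo_le (S : Finset ℕ) : ∑ d ∈ S, kappa d / ordTwo d ≤ 6 * Real.exp 14 := by
  classical
  rw [← Finset.sum_filter_add_sum_filter_not S (fun d => Odd d ∧ Squarefree d)]
  have h0 : ∑ d ∈ S.filter (fun d => ¬ (Odd d ∧ Squarefree d)), kappa d / ordTwo d = 0 := by
    refine Finset.sum_eq_zero fun d hd => ?_
    rw [kappa_apply, if_neg (Finset.mem_filter.mp hd).2, zero_div]
  rw [h0, add_zero]
  have h1 : ∑ d ∈ S.filter (fun d => Odd d ∧ Squarefree d), kappa d / ordTwo d =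
      ∑ d ∈ S.filter (fun d => Odd d ∧ Squarefree d), kWeight d / ordTwo d := by
    refine Finset.sum_congr rfl fun d hd => ?_
    rw [kappa_apply, if_pos (Finset.mem_filter.mp hd).2]
  rw [h1]
  exact sum_kWeight_div_ordTwo_le _ fun d hd => (Finset.mem_filter.mp hd).2

/-- **Romanov's series (with the weight `k`) converges.** [cite: PintzRuzsa2003, §8 (8.14)] -/
theorem summable_kappa_div_ordTwo : Summable fun d : ℕ => kappa d / ordTwo d :=
  summable_of_sum_le kappa_div_ordTwo_nonneg sum_kappa_div_ordTwo_le

/-- Every partial sum is `≤ R₀`; in particular `F₀(L) ≤ R₀`. [cite: PintzRuzsa2003, §8 (8.13)–(8.14)] -/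
theorem sum_kappa_div_ordTwo_le_romanovConstPR (S : Finset ℕ) :
    ∑ d ∈ S, kappa d / ordTwo d ≤ romanovConstPR :=
  summable_kappa_div_ordTwo.sum_le_tsum S fun d _ => kappa_div_ordTwo_nonneg d

/-- `0 ≤ R₀ ≤ 6e¹⁴`. [folklore] -/
theorem romanovConstPR_nonneg : 0 ≤ romanovConstPR := tsum_nonneg kappa_div_ordTwo_nonneg

/-! ### (8.8)–(8.13): `∑_{1 ≤ m₁ < m₂ ≤ L} f(2^{m₂} - 2^{m₁}) ≤ (L²/2) R₀` -/

/-- **(8.12)**: for `ϱ ≥ 1`, `2ϱ ∑_{m < n} (L - (m+1)ϱ) = L² - (L - nϱ)² - nϱ²`, hence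
`∑_{1 ≤ l < L, ϱ ∣ l} (L - l) ≤ L²/(2ϱ)`. [cite: PintzRuzsa2003, §8 (8.12)] -/
theorem sum_filter_dvd_sub_le {ρ : ℕ} (hρ : 0 < ρ) (L : ℕ) :
    ∑ l ∈ (Finset.Ico 1 L).filter (ρ ∣ ·), ((L : ℝ) - l) ≤ (L : ℝ) ^ 2 / (2 * ρ) := by
  classical
  set n := (L - 1) / ρ with hn
  -- the multiples `(m+1)ρ`, `m < n`, are exactly the `l ∈ [1, L)` with `ρ ∣ l`
  have hset : (Finset.Ico 1 L).filter (ρ ∣ ·) = (Finset.range n).image fun m => (m + 1) * ρ := by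
    ext l
    rw [Finset.mem_filter, Finset.mem_Ico, Finset.mem_image]
    constructor
    · rintro ⟨⟨h1, hL⟩, q, rfl⟩
      have hq : 0 < q := Nat.pos_of_ne_zero fun h0 => by subst h0; simp at h1
      refine ⟨q - 1, Finset.mem_range.mpr ?_, by rw [Nat.sub_add_cancel hq, mul_comm]⟩
      have : q ≤ n := by
        rw [hn, Nat.le_div_iff_mul_le hρ]
        have : q * ρ = ρ * q := mul_comm _ _
        omega
      omega
    · rintro ⟨m, hm, rfl⟩
      rw [Finset.mem_range] at hm
      have hle : (m + 1) * ρ ≤ n * ρ := Nat.mul_le_mul_right _ hm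
      have hnρ : n * ρ ≤ L - 1 := by rw [hn]; exact Nat.div_mul_le_self _ _
      have hpos : 0 < (m + 1) * ρ := Nat.mul_pos (Nat.succ_pos m) hρ
      exact ⟨⟨hpos, by omega⟩, Dvd.intro_left _ rfl⟩
  have hinj : Function.Injective fun m : ℕ => (m + 1) * ρ := fun a b h => by
    have := Nat.eq_of_mul_eq_mul_right hρ h
    omega
  rw [hset, Finset.sum_image fun a _ b _ h => hinj h]
  -- the identity `2ρ S(n) = L² - (L - nρ)² - nρ²`
  have hid : ∀ n : ℕ, 2 * (ρ : ℝ) * ∑ m ∈ Finset.range n, ((L : ℝ) - (((m + 1) * ρ : ℕ) : ℝ)) =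
      (L : ℝ) ^ 2 - ((L : ℝ) - n * ρ) ^ 2 - n * (ρ : ℝ) ^ 2 := by
    intro n
    induction n with
    | zero => simp
    | succ n ih =>
        rw [Finset.sum_range_succ, mul_add, ih]
        push_cast
        ring
  have hρ' : (0 : ℝ) < ρ := by exact_mod_cast hρ
  rw [le_div_iff₀ (by positivity)]
  have h := hid n
  nlinarith [sq_nonneg ((L : ℝ) - n * ρ), mul_nonneg (Nat.cast_nonneg n) (sq_nonneg (ρ : ℝ))]

/-- **(8.11)–(8.13)**: `∑_{1 ≤ l < L} (L - l) f(2^l - 1) ≤ (L²/2) ∑'_{d < 2^L} k(d)/ϱ(d) ≤ (L²/2) R₀`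
(expand `f(2^l - 1) = ∑'_{d ∣ 2^l-1} k(d)`, swap, `d ∣ 2^l - 1 ↔ ϱ(d) ∣ l`, and (8.12)). Pintz–Ruzsa
state this as `F(L) := (2/L) ∑_{l<L} (1 - l/L) f(2^l - 1) ≤ F₀(L) → R₀`. [cite: PintzRuzsa2003, §8 (8.11)–(8.13)] -/
theorem sum_Ico_sub_mul_fWeight_le (L : ℕ) :
    ∑ l ∈ Finset.Ico 1 L, ((L : ℝ) - l) * fWeight (2 ^ l - 1) ≤ (L : ℝ) ^ 2 / 2 * romanovConstPR := by
  classical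
  set D : Finset ℕ := (Finset.range (2 ^ L)).filter fun d => Odd d ∧ Squarefree d with hD
  have hD' : ∀ d ∈ D, Odd d ∧ Squarefree d := fun d hd => (Finset.mem_filter.mp hd).2
  -- Step 1: `f(2^l - 1) = ∑_{d ∈ D, d ∣ 2^l - 1} κ(d)`
  have hstep1 : ∀ l ∈ Finset.Ico 1 L, fWeight (2 ^ l - 1) =
      ∑ d ∈ D, if d ∣ 2 ^ l - 1 then kappa d else 0 := by
    intro l hl
    obtain ⟨hl1, hlL⟩ := Finset.mem_Ico.mp hl
    have hn0 : 2 ^ l - 1 ≠ 0 := by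
      have : 2 ≤ 2 ^ l := by
        calc (2 : ℕ) = 2 ^ 1 := by norm_num
          _ ≤ 2 ^ l := Nat.pow_le_pow_right (by norm_num) hl1
      omega
    rw [fWeight_eq_sum_divisors hn0, ← Finset.sum_filter]
    symm
    refine Finset.sum_subset_zero_on_sdiff ?_ ?_ (fun _ _ => rfl)
    · intro d hd
      rw [Finset.mem_filter] at hd
      exact Nat.mem_divisors.mpr ⟨hd.2, hn0⟩
    · intro d hd
      rw [Finset.mem_sdiff, Nat.mem_divisors, Finset.mem_filter, not_and'] at hd
      have hdvd := hd.1.1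
      have hnD : d ∉ D := hd.2 hdvd
      rw [kappa_apply, if_neg]
      rintro ⟨hodd, hsq⟩
      apply hnD
      rw [hD, Finset.mem_filter, Finset.mem_range]
      refine ⟨?_, hodd, hsq⟩
      calc d ≤ 2 ^ l - 1 := Nat.le_of_dvd (Nat.pos_of_ne_zero hn0) hdvd
        _ < 2 ^ l := Nat.sub_lt (by positivity) one_pos
        _ ≤ 2 ^ L := Nat.pow_le_pow_right (by norm_num) hlL.le
  -- Step 2: swap and bound the inner sums by (8.12)
  have hinner : ∀ d ∈ D, ∑ l ∈ Finset.Ico 1 L, ((L : ℝ) - l) * (if d ∣ 2 ^ l - 1 then kappa d else 0) ≤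
      kappa d * ((L : ℝ) ^ 2 / (2 * ordTwo d)) := by
    intro d hd
    have he : 0 < ordTwo d := ordTwo_pos (hD' d hd).1
    have hk : 0 ≤ kappa d := kappa_nonneg d
    have hre : ∑ l ∈ Finset.Ico 1 L, ((L : ℝ) - l) * (if d ∣ 2 ^ l - 1 then kappa d else 0) =
        kappa d * ∑ l ∈ (Finset.Ico 1 L).filter (ordTwo d ∣ ·), ((L : ℝ) - l) := by
      rw [Finset.mul_sum, Finset.sum_filter]
      refine Finset.sum_congr rfl fun l _ => ?_
      have hiff := dvd_two_pow_sub_one_iff (d := d) l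
      by_cases h : d ∣ 2 ^ l - 1
      · rw [if_pos h, if_pos (hiff.mp h)]; ring
      · rw [if_neg h, if_neg fun h' => h (hiff.mpr h')]; ring
    rw [hre]
    exact mul_le_mul_of_nonneg_left (sum_filter_dvd_sub_le he L) hk
  calc ∑ l ∈ Finset.Ico 1 L, ((L : ℝ) - l) * fWeight (2 ^ l - 1)
      = ∑ l ∈ Finset.Ico 1 L, ((L : ℝ) - l) * ∑ d ∈ D, (if d ∣ 2 ^ l - 1 then kappa d else 0) :=
        Finset.sum_congr rfl fun l hl => by rw [hstep1 l hl]
    _ = ∑ l ∈ Finset.Ico 1 L, ∑ d ∈ D, ((L : ℝ) - l) * (if d ∣ 2 ^ l - 1 then kappa d else 0) := by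
        refine Finset.sum_congr rfl fun l _ => ?_
        rw [Finset.mul_sum]
    _ = ∑ d ∈ D, ∑ l ∈ Finset.Ico 1 L, ((L : ℝ) - l) * (if d ∣ 2 ^ l - 1 then kappa d else 0) :=
        Finset.sum_comm
    _ ≤ ∑ d ∈ D, kappa d * ((L : ℝ) ^ 2 / (2 * ordTwo d)) := Finset.sum_le_sum hinner
    _ = (L : ℝ) ^ 2 / 2 * ∑ d ∈ D, kappa d / ordTwo d := by
        rw [Finset.mul_sum]
        refine Finset.sum_congr rfl fun d hd => ?_
        have he : (0 : ℝ) < ordTwo d := by exact_mod_cast ordTwo_pos (hD' d hd).1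
        field_simp
    _ ≤ (L : ℝ) ^ 2 / 2 * romanovConstPR :=
        mul_le_mul_of_nonneg_left (sum_kappa_div_ordTwo_le_romanovConstPR D) (by positivity)

/-- **The sum over pairs of exponents** (the shape in which (8.7) uses it): grouping the pairs
`1 ≤ m₁ < m₂ ≤ L` by `l = m₂ - m₁` (there are `L - l` of them, and
`f(2^{m₂} - 2^{m₁}) = f(2^{m₁}(2^l - 1)) = f(2^l - 1)`),
`∑_{1 ≤ m₁ < m₂ ≤ L} f(2^{m₂} - 2^{m₁}) = ∑_{l=1}^{L-1} (L - l) f(2^l - 1)`. [cite: PintzRuzsa2003, §8 (8.7)] -/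
theorem sum_pairs_fWeight_eq (L : ℕ) :
    ∑ m ∈ (Finset.Icc 1 L ×ˢ Finset.Icc 1 L).filter (fun m => m.1 < m.2), fWeight (2 ^ m.2 - 2 ^ m.1) =
      ∑ l ∈ Finset.Ico 1 L, ((L : ℝ) - l) * fWeight (2 ^ l - 1) := by
  classical
  set Pairs := (Finset.Icc 1 L ×ˢ Finset.Icc 1 L).filter (fun m : ℕ × ℕ => m.1 < m.2) with hPairs
  have hmaps : ∀ m ∈ Pairs, m.2 - m.1 ∈ Finset.Ico 1 L := by
    intro m hm
    simp only [hPairs, Finset.mem_filter, Finset.mem_product, Finset.mem_Icc] at hm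
    rw [Finset.mem_Ico]; omega
  rw [← Finset.sum_fiberwise_of_maps_to hmaps]
  refine Finset.sum_congr rfl fun l hl => ?_
  obtain ⟨hl1, hlL⟩ := Finset.mem_Ico.mp hl
  have hodd : Odd (2 ^ l - 1) := by
    have : Even (2 ^ l) := (Nat.even_pow' (by omega)).mpr even_two
    rcases this with ⟨k, hk⟩
    exact ⟨k - 1, by have : 1 ≤ 2 ^ l := Nat.one_le_two_pow; omega⟩
  -- on the fibre the summand is constant
  have hconst : ∀ m ∈ Pairs.filter (fun m => m.2 - m.1 = l), fWeight (2 ^ m.2 - 2 ^ m.1) = fWeight (2 ^ l - 1) := by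
    intro m hm
    rw [Finset.mem_filter] at hm
    have h12 : m.1 < m.2 := by
      have := hm.1; simp only [hPairs, Finset.mem_filter] at this; exact this.2
    have hm2 : m.2 = m.1 + l := by omega
    have : 2 ^ m.2 - 2 ^ m.1 = 2 ^ m.1 * (2 ^ l - 1) := by
      rw [hm2, pow_add, Nat.mul_sub, mul_one]
    rw [this, fWeight_two_pow_mul hodd]
  rw [Finset.sum_congr rfl hconst, Finset.sum_const, nsmul_eq_mul]
  congr 1
  -- the fibre has `L - l` elements: `m₁ ↦ (m₁, m₁ + l)`, `1 ≤ m₁ ≤ L - l`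
  have hfib : Pairs.filter (fun m => m.2 - m.1 = l) = (Finset.Icc 1 (L - l)).image fun a => (a, a + l) := by
    ext ⟨a, b⟩
    simp only [hPairs, Finset.mem_filter, Finset.mem_product, Finset.mem_Icc, Finset.mem_image, Prod.mk.injEq]
    constructor
    · rintro ⟨⟨⟨⟨ha1, haL⟩, hb1, hbL⟩, hab⟩, hl'⟩
      exact ⟨a, ⟨ha1, by omega⟩, rfl, by omega⟩
    · rintro ⟨a', ⟨ha1, haL⟩, rfl, rfl⟩
      exact ⟨⟨⟨⟨ha1, by omega⟩, by omega, by omega⟩, by omega⟩, by omega⟩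
  rw [hfib, Finset.card_image_of_injective _ (fun a b h => by simpa using congrArg Prod.fst h),
    Nat.card_Icc, Nat.add_sub_cancel, Nat.cast_sub hlL.le]

/-- **Pintz–Ruzsa I, (8.7)–(8.14), the arithmetic factor**: for every `L`,
`∑_{1 ≤ m₁ < m₂ ≤ L} f(2^{m₂} - 2^{m₁}) ≤ (L²/2) R₀` with `R₀ = romanovConstPR`. Multiplied by
Chen's/the sieve constant `C · 2C₀ N/log² N` this is the off-diagonal part of the bound
`s(N) ≤ (2N/log² 2)(C₀R₀C + (log 2)/2 + ε)` of their Lemma 10. [cite: PintzRuzsa2003, §8 Lemma 10 (proof, (8.7)–(8.15))] -/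
theorem sum_pairs_fWeight_le (L : ℕ) :
    ∑ m ∈ (Finset.Icc 1 L ×ˢ Finset.Icc 1 L).filter (fun m => m.1 < m.2), fWeight (2 ^ m.2 - 2 ^ m.1) ≤
      (L : ℝ) ^ 2 / 2 * romanovConstPR := by
  rw [sum_pairs_fWeight_eq]
  exact sum_Ico_sub_mul_fWeight_le L

end PintzRuzsa2003

end Literature.NumberTheory.Sieve

end
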